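import Summits.BirchSwinnertonDyer.BirchSwinnertonDyer.Theorems.SylvesterTwoHeegnerIndexUpperOffV0EisensteinConj
import Literature.NumberTheory.EllipticCurves.HeegnerPointsKolyvaginPrimaryEigenProofs
import HarnessLib

/-!
# McCallum's Lemma 5.3 at `p = 2`: the eigen-pairing algebra with defect ONE

Helper file of route `SylvesterTwoHeegnerIndex` (K7t), crux `UpperOffV0HSY` (item 19581), line
`offv0-kolyvagin2`, namespace
`Summit.BirchSwinnertonDyer.BirchSwinnertonDyer.Theorems.SylvesterTwoUpper.EisensteinTorsion` (the
setting of `…UpperOffV0EisensteinTorsion` / `…EisensteinConj`: `θ² + θ + 1 = 0` on `N` of order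
`4^M`, `P` of order `2^M`, a `θ`-semilinear additive `τ` fixing `P` — complex conjugation on `E[2^M]`
for `y² = x³ − c`).  THEOREMS ONLY.

McCallum 1991, Lemma 5.3 (the `duality` field of the tree's `KolyvaginDescent.HypothesesM`) reads,
at an odd prime: for an alternating non-degenerate pairing `e` on `T = E[p^M] = T⁺ ⊕ T⁻` (both cyclic
of order `p^M`, so `e(u, w)` has order `p^M` for generators), `x ∈ T^{ν}`, `y ∈ T^{-ν}`, `p^a y ≠ 0`
and `e(x, y) = 0` force `p^{M-1-a} x = 0` (`KolyvaginEigenPow.pow_nsmul_eq_zero_of_pairing_eq_zero`).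
At `p = 2` the eigenlines `N⁺ = ℤP`, `N⁻ = ℤ(P + 2θP)` span a subgroup of INDEX `2`
(`theta_not_mem_eigen_sum`), and `e(P, P + 2θP) = 2 e(P, θP)` has order `2^{M-1}` only.  This file
proves the `p = 2` statement WITH THE RESULTING DEFECT OF EXACTLY ONE:

* `pow_nsmul_eq_zero_of_pairing_eigen_two` — `τ x = ν x`, `τ y = −ν y`, `2^a y ≠ 0`, `e(x, y) = 0`
  ⟹ **`2^{M-a} x = 0`** (not `2^{M-1-a}`).  Proof: `{P, θP}` is a basis with `e(P, θP)` of order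
  `2^M` (`KolyvaginEigenPow.addOrderOf_pairing_eq`); for `ν = 1`, `e(αP, β(P + 2θP)) = e(αP, 2βθP)`
  and the odd-`p` lemma applies to `(αP, 2βθP)` with `a − 1`; for `ν = −1` symmetrically with the
  basis `{θP, P}`.

This is the `δ = 1` of the parity-free count `…UpperOffV0DescentDefect` (`duality` with defect);
the Galois wrapper (Lemma 5.3 at `2` for `H¹(K, E[2^M])` from Kolyvagin reciprocity (R)_M, i.e. from
the registered stub (e) `stub_kolyvaginReciprocity_two`) is the tree's
`lemma_5_3_descent_of_reciprocity` with its Step 8/9 replaced by this lemma — not in this file.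
-/

set_option autoImplicit false
set_option linter.dupNamespace false

namespace Summit.BirchSwinnertonDyer.BirchSwinnertonDyer.Theorems.SylvesterTwoUpper.EisensteinTorsion

open Literature.NumberTheory.EllipticCurves

variable {N : Type*} [AddCommGroup N] (θ : N →+ N) (hθ : ∀ x, θ (θ x) + θ x + x = 0)
  (τ : N →+ N) (hτθ : ∀ x, τ (θ x) = θ (θ (τ x))) {P : N} (hτP : τ P = P)
  [Finite N] {M : ℕ} (hcard : Nat.card N = 4 ^ M) (hP : addOrderOf P = 2 ^ M)

include hθ hcard hP in
/-- `θP` has order `2^M` as well (`0·P + 1·θP`, coordinates not both even). [folklore] -/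
theorem addOrderOf_theta_eq (hM : 1 ≤ M) : addOrderOf (θ P) = 2 ^ M := by
  have h := addOrderOf_lin_eq_two_pow θ hθ hcard hP hM (a := 0) (b := 1) (by omega)
  rwa [zero_zsmul, one_zsmul, zero_add] at h

include hθ hcard hP in
/-- **`e(P, θP)` has order `2^M`** for an alternating left-non-degenerate `e` (perfectness on the
basis `{P, θP}`); likewise `e(θP, P)`. [folklore] -/
theorem addOrderOf_pairing_theta_eq (hM : 1 ≤ M) {A : Type*} [AddCommGroup A] (e : N →+ N →+ A)
    (halt : ∀ x, e x x = 0) (hnd : ∀ x, (∀ y, e x y = 0) → x = 0) :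
    addOrderOf (e P (θ P)) = 2 ^ M ∧ addOrderOf (e (θ P) P) = 2 ^ M := by
  have h2M : ∀ t : N, 2 ^ M • t = 0 := fun t ↦ by
    have := pow_mul_zsmul_eq_zero θ hθ hcard hP 1 t
    rw [mul_one] at this
    exact_mod_cast this
  have hgen : ∀ z : N, ∃ β δ : ℤ, z = β • P + δ • θ P := fun z ↦ exists_lin_eq θ hθ hcard hP z
  have hgen' : ∀ z : N, ∃ β δ : ℤ, z = β • θ P + δ • P := fun z ↦ by
    obtain ⟨β, δ, h⟩ := hgen z
    exact ⟨δ, β, by rw [h, add_comm]⟩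
  exact ⟨KolyvaginEigenPow.addOrderOf_pairing_eq Nat.prime_two hM h2M e halt hnd hgen
      (KolyvaginEigenPow.pow_pred_nsmul_ne_zero Nat.prime_two hM hP),
    KolyvaginEigenPow.addOrderOf_pairing_eq Nat.prime_two hM h2M e halt hnd hgen'
      (KolyvaginEigenPow.pow_pred_nsmul_ne_zero Nat.prime_two hM
        (addOrderOf_theta_eq θ hθ hcard hP hM))⟩

include hθ hτθ hτP hcard hP in
/-- **McCallum's Lemma 5.3 at `p = 2`, with defect one.**  In the setting of this file (`N = E[2^M]`
with `[ω] = θ` and the semilinear involution `τ`, `P` a `τ`-fixed generator), let `e` be an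
alternating left-non-degenerate biadditive pairing on `N`, `x ∈ N^{τ = ν}`, `y ∈ N^{τ = −ν}`
(`ν = ±1`) with `2^a y ≠ 0` and `e(x, y) = 0`.  Then **`2^{M-a} x = 0`** — one power of `2` weaker than
the odd-`p` conclusion `p^{M-1-a} x = 0` of `KolyvaginEigenPow.pow_nsmul_eq_zero_of_pairing_eq_zero`,
because the eigenlines `ℤP`, `ℤ(P + 2θP)` pair through `e(P, P + 2θP) = 2·e(P, θP)`.
[cite: McCallumLMS1991, §5 Lemma 5.3] -/
theorem pow_nsmul_eq_zero_of_pairing_eigen_two (hM : 1 ≤ M) {A : Type*} [AddCommGroup A]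
    (e : N →+ N →+ A) (halt : ∀ x, e x x = 0) (hnd : ∀ x, (∀ y, e x y = 0) → x = 0)
    {ν : ℤ} (hν : ν = 1 ∨ ν = -1) {x y : N} (hx : τ x = ν • x) (hy : τ y = -(ν • y))
    {a : ℕ} (ha : 2 ^ a • y ≠ 0) (hexy : e x y = 0) : 2 ^ (M - a) • x = 0 := by
  have h2M : ∀ t : N, 2 ^ M • t = 0 := fun t ↦ by
    have := pow_mul_zsmul_eq_zero θ hθ hcard hP 1 t
    rw [mul_one] at this
    exact_mod_cast this
  have hθPord := addOrderOf_theta_eq θ hθ hcard hP hM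
  obtain ⟨hω1, hω2⟩ := addOrderOf_pairing_theta_eq θ hθ hcard hP hM e halt hnd
  -- `a < M`, else `2^a y = 0`
  have haM : a < M := by
    by_contra hle
    apply ha
    obtain ⟨r, hr⟩ := Nat.exists_eq_add_of_le (Nat.le_of_not_lt hle)
    rw [hr, pow_add, mul_comm, mul_smul, h2M, smul_zero]
  -- the orders of `P` and `θP` as divisibility criteria
  have hPiff : ∀ m : ℤ, m • P = 0 ↔ ((2 ^ M : ℕ) : ℤ) ∣ m := fun m ↦ by
    rw [← hP]; exact (addOrderOf_dvd_iff_zsmul_eq_zero).symm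
  have hθiff : ∀ m : ℤ, m • θ P = 0 ↔ ((2 ^ M : ℕ) : ℤ) ∣ m := fun m ↦ by
    rw [← hθPord]; exact (addOrderOf_dvd_iff_zsmul_eq_zero).symm
  -- `e(αP, βP) = 0 = e(αθP, βθP)`
  have hdiag : ∀ (α β : ℤ) (Q : N), e (α • Q) (β • Q) = 0 := fun α β Q ↦ by
    rw [KolyvaginEigenPow.pairing_zsmul_left, map_zsmul, halt, smul_zero, smul_zero]
  rcases hν with rfl | rfl
  · -- `ν = 1`: `x = αP`, `y = β(P + 2θP)`
    rw [one_smul] at hx hy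
    obtain ⟨α, rfl⟩ := (tau_eq_self_iff θ hθ τ hτθ hτP hcard hP x).mp hx
    obtain ⟨β, rfl⟩ := (tau_eq_neg_iff θ hθ τ hτθ hτP hcard hP y).mp hy
    by_cases ha0 : a = 0
    · subst ha0
      rw [Nat.sub_zero, h2M]
    -- `e(αP, 2βθP) = 0`
    have hexy' : e (α • P) ((2 * β) • θ P) = 0 := by
      have hsplit : β • (P + (2 : ℤ) • θ P) = β • P + (2 * β) • θ P := by
        rw [zsmul_add, smul_smul, mul_comm]
      rw [hsplit, map_add, hdiag, zero_add] at hexy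
      exact hexy
    -- `2^{a-1} (2βθP) ≠ 0`, else `2^a β` is divisible by `2^M` and `2^a y = 0`
    have hya' : 2 ^ (a - 1) • ((2 * β) • θ P) ≠ 0 := by
      intro h0
      apply ha
      rw [← natCast_zsmul, smul_smul] at h0
      have h1 : ((2 ^ M : ℕ) : ℤ) ∣ ((2 ^ (a - 1) : ℕ) : ℤ) * (2 * β) := (hθiff _).mp h0
      have h2 : ((2 ^ (a - 1) : ℕ) : ℤ) * (2 * β) = ((2 ^ a : ℕ) : ℤ) * β := by
        rw [show a = (a - 1) + 1 by omega, pow_succ, Nat.add_sub_cancel]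
        push_cast
        ring
      rw [h2] at h1
      have hP0 : (((2 ^ a : ℕ) : ℤ) * β) • P = 0 := (hPiff _).mpr h1
      have hθ0 : (((2 ^ a : ℕ) : ℤ) * β * 2) • θ P = 0 := (hθiff _).mpr (dvd_mul_of_dvd_left h1 2)
      rw [← natCast_zsmul, smul_smul, zsmul_add, smul_smul, hP0, hθ0, add_zero]
    have h := KolyvaginEigenPow.pow_nsmul_eq_zero_of_pairing_eq_zero Nat.prime_two h2M e
      (u := P) (w := θ P) (AddSubgroup.mem_zmultiples_iff.mpr ⟨α, rfl⟩)
      (AddSubgroup.mem_zmultiples_iff.mpr ⟨2 * β, rfl⟩) hω1 hya' hexy'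
    rwa [show M - 1 - (a - 1) = M - a by omega] at h
  · -- `ν = -1`: `x = α(P + 2θP)`, `y = βP`
    rw [neg_one_zsmul] at hx hy
    rw [neg_neg] at hy
    obtain ⟨α, rfl⟩ := (tau_eq_neg_iff θ hθ τ hτθ hτP hcard hP x).mp hx
    obtain ⟨β, rfl⟩ := (tau_eq_self_iff θ hθ τ hτθ hτP hcard hP y).mp hy
    -- `e(2αθP, βP) = 0`
    have hsplit : α • (P + (2 : ℤ) • θ P) = α • P + (2 * α) • θ P := by
      rw [zsmul_add, smul_smul, mul_comm]
    have hexy' : e ((2 * α) • θ P) (β • P) = 0 := by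
      rw [hsplit, map_add, AddMonoidHom.add_apply, hdiag, zero_add] at hexy
      exact hexy
    have h := KolyvaginEigenPow.pow_nsmul_eq_zero_of_pairing_eq_zero Nat.prime_two h2M e
      (u := θ P) (w := P) (AddSubgroup.mem_zmultiples_iff.mpr ⟨2 * α, rfl⟩)
      (AddSubgroup.mem_zmultiples_iff.mpr ⟨β, rfl⟩) hω2 ha hexy'
    -- `2^{M-1-a} (2αθP) = 0`, so `2^M ∣ 2^{M-a} α` and `2^{M-a} x = 0`
    rw [← natCast_zsmul, smul_smul] at h
    have h1 : ((2 ^ M : ℕ) : ℤ) ∣ ((2 ^ (M - 1 - a) : ℕ) : ℤ) * (2 * α) := (hθiff _).mp h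
    have h2 : ((2 ^ (M - 1 - a) : ℕ) : ℤ) * (2 * α) = ((2 ^ (M - a) : ℕ) : ℤ) * α := by
      rw [show M - a = (M - 1 - a) + 1 by omega, pow_succ]
      push_cast
      ring
    rw [h2] at h1
    have hP0 : (((2 ^ (M - a) : ℕ) : ℤ) * α) • P = 0 := (hPiff _).mpr h1
    have hθ0 : (((2 ^ (M - a) : ℕ) : ℤ) * (2 * α)) • θ P = 0 := (hθiff _).mpr (by
      rw [show ((2 ^ (M - a) : ℕ) : ℤ) * (2 * α) = 2 * (((2 ^ (M - a) : ℕ) : ℤ) * α) by ring]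
      exact dvd_mul_of_dvd_right h1 2)
    rw [hsplit, ← natCast_zsmul, zsmul_add, smul_smul, smul_smul, hP0, hθ0, add_zero]

/-! ### Appendix (k7t-c2 g4, same session): the defect one is SHARP -/

include hθ hτθ hτP hcard hP in
/-- **The defect of Lemma 5.3 at `2` cannot be removed at the level of `E[2^M]`.**  For EVERY
biadditive alternating pairing `e` on `N` (no non-degeneracy needed) the odd-`p` conclusion
`2^{M-1-a} x = 0` of `KolyvaginEigenPow.pow_nsmul_eq_zero_of_pairing_eq_zero` FAILS at `2`: the
`τ`-fixed `x = 2^{M-1} P ≠ 0` and the `τ`-anti-fixed `y = P + 2θP` (of order `2^M`, so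
`2^{M-1} y ≠ 0`, `a = M - 1`) pair to `e(x, y) = 2^M e(P, θP) = 0`, while `2^{M-1-a} x = x ≠ 0`.  So
`pow_nsmul_eq_zero_of_pairing_eigen_two` (`2^{M-a} x = 0`) is optimal, and any 2-adic descent fed
by McCallum's Lemma 5.3 through the eigenlines of `E[2^M]` carries `δ = 1` — a typed piece of the
obstruction to the constant-zero bound of the crux (not a statement about actual Selmer classes).
[cite: McCallumLMS1991, §5 Lemma 5.3] -/
theorem exists_pairing_eigen_defect_witness (hM : 1 ≤ M) {A : Type*} [AddCommGroup A]
    (e : N →+ N →+ A) (halt : ∀ x, e x x = 0) :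
    ∃ (x y : N) (a : ℕ), τ x = x ∧ τ y = -y ∧ 2 ^ a • y ≠ 0 ∧ e x y = 0 ∧
      2 ^ (M - 1 - a) • x ≠ 0 := by
  have hPM : 2 ^ (M - 1) • P ≠ 0 := KolyvaginEigenPow.pow_pred_nsmul_ne_zero Nat.prime_two hM hP
  have hQ : addOrderOf (P + (2 : ℤ) • θ P) = 2 ^ M := by
    have h := addOrderOf_lin_eq_two_pow θ hθ hcard hP hM (a := 1) (b := 2) (by omega)
    rwa [one_zsmul] at h
  have hQM : 2 ^ (M - 1) • (P + (2 : ℤ) • θ P) ≠ 0 :=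
    KolyvaginEigenPow.pow_pred_nsmul_ne_zero Nat.prime_two hM hQ
  have h2MP : 2 ^ M • P = 0 := by
    have := addOrderOf_nsmul_eq_zero P
    rwa [hP] at this
  refine ⟨2 ^ (M - 1) • P, P + (2 : ℤ) • θ P, M - 1, ?_, ?_, hQM, ?_, ?_⟩
  · rw [map_nsmul, hτP]
  · exact (tau_eq_neg_iff θ hθ τ hτθ hτP hcard hP _).mpr ⟨1, by rw [one_zsmul]⟩
  · -- `e(2^{M-1} P, P + 2θP) = 2^{M-1} e(P, P) + 2^M e(P, θP) = e(2^M P, θP) = 0`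
    rw [← natCast_zsmul, KolyvaginEigenPow.pairing_zsmul_left, map_add, halt, zero_add, map_zsmul,
      smul_smul, ← KolyvaginEigenPow.pairing_zsmul_left,
      show ((2 ^ (M - 1) : ℕ) : ℤ) * 2 = ((2 ^ M : ℕ) : ℤ) by
        rw [show M = (M - 1) + 1 by omega, pow_succ, Nat.add_sub_cancel]; push_cast; ring,
      natCast_zsmul, h2MP, map_zero, AddMonoidHom.zero_apply]
  · rwa [Nat.sub_self, pow_zero, one_smul]

end Summit.BirchSwinnertonDyer.BirchSwinnertonDyer.Theorems.SylvesterTwoUpper.EisensteinTorsion
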